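import Mathlib
import Summits.NavierStokesRegularity.NavierStokesRegularity.Theorems.EulerZoomLiouvillePowerGaugeEulerLiouvilleSelfSimilarBernoulliSqueezeSobolev
import HarnessLib.Audit

/-!
# Crux `EulerZoomLiouville.PowerGaugeEulerLiouville` (stmt-NavierStokesRegularity-19832), THE ONE STATEMENT `stub_selfSimilarC2Needle`:
# THE FAST SET IS SOBOLEV-THIN — EVENTUALLY-form of the data (growths known only for `L ≥ L₀`)

Route №10 `EulerZoomLiouville` (NavierStokesRegularity), crux E = stmt-NavierStokesRegularity-19832; width seat ns-ezl-w1 g3 at the LEAD's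
(ns-typeII-p2 g12, STATUS 13:58:49Z) request.  LEAD g11's `Loc.volume_fastSet_inter_shell_le_sobolev` / `…far_le_sobolev`
(`…SelfSimilarBernoulliSqueezeSobolev`, p636011) take the class growths `∫_{B_L}|V|² ≤ c_A L^{1−2ρ}`, `∫_{B_L}‖∇V‖² ≤ c_E L^{1−ρ}` for ALL `L > 0`,
but PAST/SHIFTED profiles only have them for `L ≥ L₀` (`Past.exists_profileGradient_growth_of_past`: `L ≥ 2 − T₁`).  Since the proof spends the data
at the single scale `5L`, the same argument gives:

* `Loc.volume_fastSet_inter_shell_le_sobolev_of_eventually` — data for `L ≥ L₀` ⇒ `vol({a‖y‖ ≤ ‖V y‖} ∩ {L ≤ ‖y‖ ≤ 2L}) ≤ K L^{−3−3ρ}` for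
  `L ≥ max 1 L₀`;
* `Loc.volume_fastSet_inter_far_le_sobolev_of_eventually` — `vol({a‖y‖ ≤ ‖V y‖} ∩ {R ≤ ‖y‖}) ≤ K′ R^{−3−3ρ}` for `R ≥ max 1 L₀` (`ρ > −1`)
  (g11's whole-range statements are the case `L₀ ≤ 1`).

Shared input of ns-ezl-w5 g2's past twin `Past.selfSimilar_ae_eq_zero_of_vorticalFastChannelC2_profile_sharp_past` and of ns-ezl-w2's past
NeedleRace chain.  WHAT THIS IS NOT: not NS, not E — a brick; 19832 is OPEN. [folklore; Gagliardo–Nirenberg–Sobolev inequality]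
-/

noncomputable section

set_option linter.dupNamespace false

open MeasureTheory Set Filter Topology Metric Function InnerProductSpace Module
open scoped RealInnerProductSpace NNReal ENNReal ContDiff

namespace Summit.NavierStokesRegularity.NavierStokesRegularity.Theorems.PowerGaugeEulerLiouville.Loc

open Literature.Analysis Literature.Analysis.FluidPDE

/-- **THE FAST SET IS SOBOLEV-THIN ON DYADIC SHELLS, eventually-form.**  `V ∈ C¹` with the class growths
`∫_{B_L}|V|² ≤ c_A L^{1−2ρ}` and `∫_{B_L}‖∇V‖² ≤ c_E L^{1−ρ}` FOR `L ≥ L₀` ONLY, `ρ ≥ −2`, `a > 0`: for `L ≥ max 1 L₀`,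
`vol({a‖y‖ ≤ ‖V y‖} ∩ {L ≤ ‖y‖ ≤ 2L}) ≤ K L^{−3−3ρ}` (GNS on `χ_L • V` at the scale `5L ≥ L₀`, Chebyshev in `L⁶`). [folklore; GNS inequality] -/
theorem volume_fastSet_inter_shell_le_sobolev_of_eventually {ρ : ℝ} (hρ : -2 ≤ ρ)
    {V : EuclideanSpace ℝ (Fin 3) → EuclideanSpace ℝ (Fin 3)} (hV : ContDiff ℝ 1 V) {cA cE L₀ : ℝ} (hcA : 0 ≤ cA) (hcE : 0 ≤ cE)
    (hA : ∀ L : ℝ, L₀ ≤ L → ∫⁻ y in ball (0 : EuclideanSpace ℝ (Fin 3)) L, ‖V y‖ₑ ^ 2 ≤ ENNReal.ofReal (cA * L ^ (1 - 2 * ρ)))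
    (hE : ∀ L : ℝ, L₀ ≤ L → ∫⁻ y in ball (0 : EuclideanSpace ℝ (Fin 3)) L, ‖fderiv ℝ V y‖ₑ ^ 2 ≤
      ENNReal.ofReal (cE * L ^ (1 - ρ)))
    {a : ℝ} (ha : 0 < a) :
    ∃ K : ℝ, 0 ≤ K ∧ ∀ L : ℝ, max 1 L₀ ≤ L →
      volume ({y : EuclideanSpace ℝ (Fin 3) | a * ‖y‖ ≤ ‖V y‖} ∩ {y | L ≤ ‖y‖ ∧ ‖y‖ ≤ 2 * L}) ≤
        ENNReal.ofReal (K * L ^ (-3 - 3 * ρ)) := by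
  -- adapted from LEAD g11's `volume_fastSet_inter_shell_le_sobolev` (…SelfSimilarBernoulliSqueezeSobolev): the data are used at the scale `5L ≥ L₀` only
  obtain ⟨M, hM0, hcut⟩ := exists_scaledCutoff
  set K₁ : ℝ := 2 * (cE * 5 ^ (1 - ρ)) + 2 * M ^ 2 * (cA * 5 ^ (1 - 2 * ρ)) with hK₁
  have hK₁0 : 0 ≤ K₁ := by positivity
  set Cr : ℝ := ((eLpNormLESNormFDerivOfEqInnerConst (volume : Measure (EuclideanSpace ℝ (Fin 3))) 2 : ℝ≥0) : ℝ) with hCr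
  have hCr0 : 0 ≤ Cr := NNReal.coe_nonneg _
  refine ⟨Cr ^ 6 * K₁ ^ 3 / a ^ 6, by positivity, fun L hLmax => ?_⟩
  have hL : 1 ≤ L := (le_max_left _ _).trans hLmax
  have hL0 : 0 < L := one_pos.trans_le hL
  obtain ⟨χ, hχ1, hχc, h0, h1, hone, hzero, hdχ⟩ := hcut L hL0
  have h5L : L₀ ≤ 5 * L := ((le_max_right _ _).trans hLmax).trans (by linarith)
  -- ### the `L⁶` bound
  have hI6 := lintegral_norm_pow_six_le_of_cutoff hV hχ1 hχc h1 h0 hL0 hone hzero hdχ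
  have hE' := hE (5 * L) h5L
  have hA' := hA (5 * L) h5L
  set E' : ℝ := cE * (5 * L) ^ (1 - ρ) with hE'def
  set A' : ℝ := cA * (5 * L) ^ (1 - 2 * ρ) with hA'def
  set m2 : ℝ := (M / L) ^ 2 with hm2
  have hE'0 : 0 ≤ E' := by positivity
  have hA'0 : 0 ≤ A' := by positivity
  have hm20 : 0 ≤ m2 := by positivity
  set X : ℝ := 2 * E' + 2 * m2 * A' with hX
  have hX0 : 0 ≤ X := by positivity
  have hofX : ENNReal.ofReal X = 2 * ENNReal.ofReal E' + 2 * ENNReal.ofReal m2 * ENNReal.ofReal A' := by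
    have h2m : (0 : ℝ) ≤ 2 * m2 := by positivity
    rw [hX, ENNReal.ofReal_add (by positivity) (by positivity), ENNReal.ofReal_mul (by norm_num : (0 : ℝ) ≤ 2),
      ENNReal.ofReal_mul h2m, ENNReal.ofReal_mul (by norm_num : (0 : ℝ) ≤ 2), ENNReal.ofReal_ofNat]
  have hI6' : ∫⁻ y in closedBall (0 : EuclideanSpace ℝ (Fin 3)) (2 * L), ‖V y‖ₑ ^ 6 ≤
      ENNReal.ofReal (Cr ^ 6 * X ^ 3) := by
    refine hI6.trans ?_
    calc (eLpNormLESNormFDerivOfEqInnerConst (volume : Measure (EuclideanSpace ℝ (Fin 3))) 2 : ℝ≥0∞) ^ 6 * ((2 * ∫⁻ y in ball (0 : EuclideanSpace ℝ (Fin 3)) (5 * L), ‖fderiv ℝ V y‖ₑ ^ 2) +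
          2 * ENNReal.ofReal ((M / L) ^ 2) * ∫⁻ y in ball (0 : EuclideanSpace ℝ (Fin 3)) (5 * L), ‖V y‖ₑ ^ 2) ^ 3
        ≤ (eLpNormLESNormFDerivOfEqInnerConst (volume : Measure (EuclideanSpace ℝ (Fin 3))) 2 : ℝ≥0∞) ^ 6 * (2 * ENNReal.ofReal E' + 2 * ENNReal.ofReal m2 * ENNReal.ofReal A') ^ 3 := by gcongr
      _ = ENNReal.ofReal (Cr ^ 6 * X ^ 3) := by
          rw [← hofX, ← ENNReal.ofReal_pow hX0, hCr, ← ENNReal.ofReal_coe_nnreal, ← ENNReal.ofReal_pow (NNReal.coe_nonneg _),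
            ← ENNReal.ofReal_mul (by positivity)]
  -- ### `X ≤ K₁ L^{1−ρ}`
  have hXK : X ≤ K₁ * L ^ (1 - ρ) := by
    have hP : 0 < L ^ (1 - ρ) := Real.rpow_pos_of_pos hL0 _
    have e1 : E' = cE * 5 ^ (1 - ρ) * L ^ (1 - ρ) := by
      rw [hE'def, Real.mul_rpow (by norm_num) hL0.le, mul_assoc]
    have e2 : A' = cA * 5 ^ (1 - 2 * ρ) * L ^ (1 - 2 * ρ) := by
      rw [hA'def, Real.mul_rpow (by norm_num) hL0.le, mul_assoc]
    have hml : m2 * L ^ (1 - 2 * ρ) ≤ M ^ 2 * L ^ (1 - ρ) := by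
      have hL2 : m2 = M ^ 2 * L ^ (-2 : ℝ) := by
        rw [hm2, div_pow, Real.rpow_neg hL0.le, show (L ^ (2 : ℝ)) = L ^ 2 from Real.rpow_two L, div_eq_mul_inv]
      rw [hL2, mul_assoc, ← Real.rpow_add hL0]
      exact mul_le_mul_of_nonneg_left (Real.rpow_le_rpow_of_exponent_le hL (by linarith)) (sq_nonneg _)
    have h5a : 0 ≤ cE * 5 ^ (1 - ρ) := by positivity
    have h5b : 0 ≤ cA * 5 ^ (1 - 2 * ρ) := by positivity
    have key : m2 * A' ≤ M ^ 2 * (cA * 5 ^ (1 - 2 * ρ)) * L ^ (1 - ρ) := by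
      rw [e2, show m2 * (cA * 5 ^ (1 - 2 * ρ) * L ^ (1 - 2 * ρ)) = cA * 5 ^ (1 - 2 * ρ) * (m2 * L ^ (1 - 2 * ρ)) by ring]
      calc cA * 5 ^ (1 - 2 * ρ) * (m2 * L ^ (1 - 2 * ρ)) ≤ cA * 5 ^ (1 - 2 * ρ) * (M ^ 2 * L ^ (1 - ρ)) :=
            mul_le_mul_of_nonneg_left hml h5b
        _ = M ^ 2 * (cA * 5 ^ (1 - 2 * ρ)) * L ^ (1 - ρ) := by ring
    rw [hX, hK₁, e1]
    nlinarith [key]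
  -- ### Chebyshev on the set
  set S : Set (EuclideanSpace ℝ (Fin 3)) := {y | a * ‖y‖ ≤ ‖V y‖} ∩ {y | L ≤ ‖y‖ ∧ ‖y‖ ≤ 2 * L} with hS
  have haL : 0 < (a * L) ^ 6 := by positivity
  have hcheb : ENNReal.ofReal ((a * L) ^ 6) * volume S ≤ ENNReal.ofReal (Cr ^ 6 * X ^ 3) := by
    calc ENNReal.ofReal ((a * L) ^ 6) * volume S = ∫⁻ _ in S, ENNReal.ofReal ((a * L) ^ 6) := (setLIntegral_const S _).symm
      _ ≤ ∫⁻ y in S, ‖V y‖ₑ ^ 6 := by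
          refine lintegral_mono_ae ((ae_restrict_iff' ?_).2 (Eventually.of_forall fun y hy => ?_))
          · exact (isClosed_le (continuous_const.mul continuous_norm) hV.continuous.norm).measurableSet.inter
              ((isClosed_le continuous_const continuous_norm).inter (isClosed_le continuous_norm continuous_const)).measurableSet
          · obtain ⟨hyV, hyL, -⟩ := hy
            rw [← ofReal_norm, ← ENNReal.ofReal_pow (norm_nonneg _)]
            apply ENNReal.ofReal_le_ofReal
            have haL' : a * L ≤ ‖V y‖ := le_trans (mul_le_mul_of_nonneg_left hyL ha.le) hyV
            exact pow_le_pow_left₀ (by positivity) haL' 6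
      _ ≤ ∫⁻ y in closedBall (0 : EuclideanSpace ℝ (Fin 3)) (2 * L), ‖V y‖ₑ ^ 6 := by
          refine lintegral_mono_set fun y hy => ?_
          rw [mem_closedBall, dist_zero_right]
          exact hy.2.2
      _ ≤ ENNReal.ofReal (Cr ^ 6 * X ^ 3) := hI6'
  have hvol : volume S ≤ ENNReal.ofReal (Cr ^ 6 * X ^ 3) / ENNReal.ofReal ((a * L) ^ 6) := by
    rw [ENNReal.le_div_iff_mul_le (Or.inl ((ENNReal.ofReal_pos.2 haL).ne')) (Or.inl ENNReal.ofReal_ne_top), mul_comm]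
    exact hcheb
  refine hvol.trans ?_
  rw [← ENNReal.ofReal_div_of_pos haL]
  apply ENNReal.ofReal_le_ofReal
  -- ### real bookkeeping: `Cr⁶ X³ / (aL)⁶ ≤ (Cr⁶ K₁³ / a⁶) L^{−3−3ρ}`
  have hP : 0 < L ^ (1 - ρ) := Real.rpow_pos_of_pos hL0 _
  have hX3 : X ^ 3 ≤ (K₁ * L ^ (1 - ρ)) ^ 3 := pow_le_pow_left₀ hX0 hXK 3
  have hrpow : (L ^ (1 - ρ)) ^ 3 / L ^ 6 = L ^ (-3 - 3 * ρ) := by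
    rw [← Real.rpow_natCast (L ^ (1 - ρ)) 3, ← Real.rpow_mul hL0.le, ← Real.rpow_natCast L 6,
      ← Real.rpow_sub hL0]
    norm_num
    ring_nf
  calc Cr ^ 6 * X ^ 3 / (a * L) ^ 6 ≤ Cr ^ 6 * (K₁ * L ^ (1 - ρ)) ^ 3 / (a * L) ^ 6 := by
        gcongr
    _ = Cr ^ 6 * K₁ ^ 3 / a ^ 6 * ((L ^ (1 - ρ)) ^ 3 / L ^ 6) := by
        rw [mul_pow, mul_pow]; ring
    _ = Cr ^ 6 * K₁ ^ 3 / a ^ 6 * L ^ (-3 - 3 * ρ) := by rw [hrpow]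

/-- **THE FAST SET IS SOBOLEV-THIN FAR OUT, eventually-form**: under the hypotheses of
`volume_fastSet_inter_shell_le_sobolev_of_eventually` and `ρ > −1`, there is `K′ ≥ 0` with
`vol({a‖y‖ ≤ ‖V y‖} ∩ {R ≤ ‖y‖}) ≤ K′ R^{−3−3ρ}` for all `R ≥ max 1 L₀` (dyadic tail `volume_inter_far_le_of_shell`).
[folklore; GNS inequality] -/
theorem volume_fastSet_inter_far_le_sobolev_of_eventually {ρ : ℝ} (hρ : -1 < ρ)
    {V : EuclideanSpace ℝ (Fin 3) → EuclideanSpace ℝ (Fin 3)} (hV : ContDiff ℝ 1 V) {cA cE L₀ : ℝ} (hcA : 0 ≤ cA) (hcE : 0 ≤ cE)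
    (hA : ∀ L : ℝ, L₀ ≤ L → ∫⁻ y in ball (0 : EuclideanSpace ℝ (Fin 3)) L, ‖V y‖ₑ ^ 2 ≤ ENNReal.ofReal (cA * L ^ (1 - 2 * ρ)))
    (hE : ∀ L : ℝ, L₀ ≤ L → ∫⁻ y in ball (0 : EuclideanSpace ℝ (Fin 3)) L, ‖fderiv ℝ V y‖ₑ ^ 2 ≤
      ENNReal.ofReal (cE * L ^ (1 - ρ)))
    {a : ℝ} (ha : 0 < a) :
    ∃ K' : ℝ, 0 ≤ K' ∧ ∀ R : ℝ, max 1 L₀ ≤ R →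
      volume ({y : EuclideanSpace ℝ (Fin 3) | a * ‖y‖ ≤ ‖V y‖} ∩ {y | R ≤ ‖y‖}) ≤ ENNReal.ofReal (K' * R ^ (-3 - 3 * ρ)) := by
  -- adapted from LEAD g11's `volume_fastSet_inter_far_le_sobolev`
  obtain ⟨K, hK0, hshell⟩ := volume_fastSet_inter_shell_le_sobolev_of_eventually (by linarith) hV hcA hcE hA hE ha
  have hs : (-3 - 3 * ρ : ℝ) < 0 := by linarith
  have hM0 : (0 : ℝ) < max 1 L₀ := lt_of_lt_of_le one_pos (le_max_left _ _)
  refine ⟨|K| * (1 - (2 : ℝ) ^ (-3 - 3 * ρ))⁻¹, ?_, fun R hR => volume_inter_far_le_of_shell _ hM0 hs hshell hR⟩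
  have h2s1 : (2 : ℝ) ^ (-3 - 3 * ρ) < 1 := Real.rpow_lt_one_of_one_lt_of_neg (by norm_num) hs
  have : 0 < (1 - (2 : ℝ) ^ (-3 - 3 * ρ))⁻¹ := inv_pos.2 (by linarith)
  positivity

end Summit.NavierStokesRegularity.NavierStokesRegularity.Theorems.PowerGaugeEulerLiouville.Loc
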